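import Literature.MathematicalPhysics.QuantumFieldTheory.Balaban1983to89.B9CoReadingCoords
import Literature.MathematicalPhysics.QuantumFieldTheory.Balaban1983to89.B9Thm311DeltaPrimeSymm
import Literature.MathematicalPhysics.QuantumFieldTheory.Balaban1983to89.B10StarCount
import Literature.MathematicalPhysics.QuantumFieldTheory.Balaban1983to89.B9Thm37GlueTorusCov
import Literature.MathematicalPhysics.QuantumFieldTheory.Balaban1983to89.B9CoReadingCoordsS

/-!
# `Balaban1983to89.B9CoReadingCoordsTranspose` — TRANSPOSES ON THE κ-FOLD COORDINATE MODEL: an orthonormal real basis turns adjointness of the letters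
# (w.r.t. a symmetric real pairing on the fibre, summed over the carrier) into `IsTransposePair` of their coordinate models

T. Bałaban, *Propagators for lattice gauge theories in a background field*, Commun. Math. Phys. **99** (1985) 389–434
[`Balaban1985BackgroundPropagators`, "B9"]; [4] = T. Bałaban, *Propagators and renormalization transformations for lattice gauge
theories. II*, Commun. Math. Phys. **96** (1984) 223–250 [`Balaban1984PropagatorsII`].

statement-level skeleton of published theorems with citation tags; proofs where landed; nothing here is a claim about the
Yang–Mills mass gap

THE PRINTED LOCI.  p. 393 (the scalar products of 𝔤-valued functions; `Q′*` the adjoint of `Q′`), Thm 3.11 p. 416 (*"It is a symmetric … operator"*),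
(3.8) p. 392 (`∇*_U` the adjoint of `∇_U`); [4] (2.69) p. 235.

THE POINT.  The N06 knit's rows 18–19 display, next to the walk-expansion schemas, the TRANSPOSE identities of the walk letters' model operators
(`hsym : IsTransposePair (G U) (G U)`, `htr : IsTransposePair (D U ∘ₗ G U) (G U ∘ₗ Dstar U)`, n06-k's `DirTranspose…`) — `B9Thm37Glue.IsTransposePair A B` meaning
`Σ_y (A u)(y)·v(y) = Σ_x u(x)·(B v)(x)` for the COUNTING pairings on the carriers.  At the coordinate pins (`B9CoReadingCoords`) the model of a letter family
`T ν : (S → 𝔸) →ₗ (S → 𝔸)` is `coordOpK b T` on `S × D × κ × κ`.  THIS FILE proves the dictionary: if the real basis `b` of the fibre is ORTHONORMAL for a symmetric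
real pairing `β` (`repr_c v = β (b c) v`) and `T′ ν` is the `β`-adjoint of `T ν` summed over `S` (`Σ_x β (Ψ x) (T ν Φ x) = Σ_x β (T′ ν Ψ x) (Φ x)`), then
`IsTransposePair (coordOpK b T) (coordOpK b T′)` — so `hsym ∕ htr` become the genuine facts «`G(U)` is symmetric», «`∇*_U` is the adjoint of `∇_U`» for the trace
pairing `Re tr(·ᴴ·)` (n06-j `B9Thm311ReadingCoords.IsSymmTr ∕ IsAdjTr`, `B9Thm311SymmAtRecordV4.symmG_parSymY`), valid for `G`-valued `U`.
* §1 `assembleK_pairing` (`Σ_c v(x,ν,c,c′)·β (b c) w = β ((assembleK b ν c′ v) x) w`), ★ `isTransposePair_coordOpK_of_adjoint` (scalars via the tree's `B9Thm37GlueTorusCov.isTransposePair_smul`);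
* §2 the fibre `M_N(ℂ)`: `trReForm` (= `Re tr(vᴴ w)`), `trReForm_symm`, `sum_trReForm_eq_trIP` (= n06-j's `trIP 1`), ★★ `isTransposePair_coordOpK_of_isSymmTr`,
  ★★ `isTransposePair_coordOpK_of_isAdjTr`;
* §3 (3.8) on the BOND sector at a unitary-valued `U`: `conjTranspose_cdB`, ★ `sum_trace_mul_cdsB` (`Σ_b tr(A\*∇\*G) = Σ_b tr((∇A)\*G)`, from
  `B9Eq39Adjoint.sum_covD_mul` component by component + n06-j's `conjTranspose_R`), `sum_trReForm_cdB` (the real-pairing form);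
* §4 at the pins of `B9CoReadingCoords`: ★★ `isTransposePair_GcoK` (the knit's `hsym∕hsymA` from `IsSymmTr 1 (O (cfg U))`), ★★ `isTransposePair_DcoK_GcoK`
  (`htr∕htrA`: `IsTransposePair (DcoK ∘ₗ GcoK) (GcoK ∘ₗ DscoK)` from the same + `cfg U` unitary-valued);
* §5 (v1.1) the ORTHONORMAL REAL TRACE BASIS `trBasis N` of `M_N(ℂ)` (matrix units and their `i`-multiples; `trCoords`, `trBasis_repr_apply`,
  `trBasis_apply`, ★ `trBasis_repr_eq_trace` = the hypothesis `hb` INHABITED) and the pin corollaries with NO basis hypothesis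
  `isTransposePair_GcoK_trBasis`, `isTransposePair_DcoK_GcoK_trBasis`;
* §6 (v1.1) the SITE sector: `sum_trReForm_cdS` ((3.8) on sites, from n06-j's `sum_trace_mul_cdsS`), ★★ `isTransposePair_GcoS` ∕ `isTransposePair_DcoS_GcoS`
  (the G′-side `hsym ∕ htr` at the pins of `B9CoReadingCoordsS`) and their `…_trBasis` forms.
HONEST SCOPE.  Finite-dimensional linear algebra; nothing of [B9] asserted.  Count-neutral; N06 NOT discharged; one finite lattice programme at fixed ε; nothing
continuum ∕ ℝ⁴ ∕ OS ∕ mass gap ∕ Clay.  Cell `pub-ymgap` (D-0062), node N06 [B9], seat `pub-ymgap-dag-n06-d` (g5), 2026-08-27.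
-/

noncomputable section

namespace Literature.MathematicalPhysics.QuantumFieldTheory.Balaban1983to89.B9CoReadingCoordsTranspose

open B9Thm37Glue (IsTransposePair)
open B9Thm37GlueTorusCov (isTransposePair_smul)
open B9CoReadingCoords (assembleK coordOpK coordOpK_apply)
open scoped Matrix

variable {𝔸 : Type} [NormedRing 𝔸] [NormedAlgebra ℂ 𝔸]
variable {κ : Type} [Fintype κ] [DecidableEq κ]
variable {S D : Type} [Fintype S] [Fintype D]

/-! ## §1 Orthonormal coordinates turn adjoints into transposes -/

omit [DecidableEq κ] [Fintype S] [Fintype D] in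
/-- the coordinates of a slice re-assemble under an orthonormal pairing: `Σ_c v(x,ν,c,c′)·β (b c) w = β ((assembleK b ν c′ v) x) w`.
[cite: Balaban1985BackgroundPropagators, p.393 (scalar products), dictionary] -/
theorem assembleK_pairing (b : Module.Basis κ ℝ 𝔸) (β : 𝔸 →ₗ[ℝ] 𝔸 →ₗ[ℝ] ℝ) (v : S × D × κ × κ → ℝ) (x : S) (ν : D) (c' : κ) (w : 𝔸) :
    ∑ c, v (x, ν, c, c') * β (b c) w = β (assembleK b ν c' v x) w := by
  simp only [assembleK, map_sum, LinearMap.sum_apply, map_smul, LinearMap.smul_apply, smul_eq_mul]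

omit [DecidableEq κ] in
/-- ★ **ADJOINT LETTERS HAVE TRANSPOSE COORDINATE MODELS**: for a symmetric real pairing `β` on the fibre with `b` orthonormal (`repr_c v = β (b c) v`) and families
`T, T′` with `T′ ν` the `β`-adjoint of `T ν` over the carrier, `IsTransposePair (coordOpK b T) (coordOpK b T′)`.
[cite: Balaban1985BackgroundPropagators, p.393 + Thm 3.11 p.416 («symmetric»), (3.8) p.392; Balaban1984PropagatorsII, (2.51) p.232, (2.69) p.235] -/
theorem isTransposePair_coordOpK_of_adjoint (b : Module.Basis κ ℝ 𝔸) (β : 𝔸 →ₗ[ℝ] 𝔸 →ₗ[ℝ] ℝ) (hβ : ∀ v w, β v w = β w v)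
    (hb : ∀ (v : 𝔸) (c : κ), b.repr v c = β (b c) v) (T T' : D → (S → 𝔸) →ₗ[ℝ] (S → 𝔸))
    (hT : ∀ (ν : D) (Φ Ψ : S → 𝔸), ∑ x, β (Ψ x) (T ν Φ x) = ∑ x, β (T' ν Ψ x) (Φ x)) :
    IsTransposePair (coordOpK b T) (coordOpK b T') := by
  intro u v
  -- both sides as sums over (ν, c′) of pairings of assembled slices
  have hL : ∑ p : S × D × κ × κ, coordOpK b T u p * v p = ∑ ν : D, ∑ c' : κ, ∑ x : S, β (assembleK b ν c' v x) (T ν (assembleK b ν c' u) x) := by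
    simp only [coordOpK_apply, hb]
    rw [Fintype.sum_prod_type]
    simp only [Fintype.sum_prod_type (f := fun q : D × κ × κ => _)]
    rw [Finset.sum_comm]
    refine Finset.sum_congr rfl fun ν _ => ?_
    rw [Finset.sum_comm]
    simp only [Fintype.sum_prod_type (f := fun q : κ × κ => _)]
    rw [Finset.sum_comm]
    refine Finset.sum_congr rfl fun c' _ => ?_
    rw [Finset.sum_comm]
    refine Finset.sum_congr rfl fun x _ => ?_
    rw [← assembleK_pairing b β v x ν c']
    refine Finset.sum_congr rfl fun c _ => ?_
    ring
  have hR : ∑ p : S × D × κ × κ, u p * coordOpK b T' v p = ∑ ν : D, ∑ c' : κ, ∑ x : S, β (assembleK b ν c' u x) (T' ν (assembleK b ν c' v) x) := by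
    simp only [coordOpK_apply, hb]
    rw [Fintype.sum_prod_type]
    simp only [Fintype.sum_prod_type (f := fun q : D × κ × κ => _)]
    rw [Finset.sum_comm]
    refine Finset.sum_congr rfl fun ν _ => ?_
    rw [Finset.sum_comm]
    simp only [Fintype.sum_prod_type (f := fun q : κ × κ => _)]
    rw [Finset.sum_comm]
    refine Finset.sum_congr rfl fun c' _ => ?_
    rw [Finset.sum_comm]
    refine Finset.sum_congr rfl fun x _ => ?_
    rw [← assembleK_pairing b β u x ν c']
  rw [hL, hR]
  refine Finset.sum_congr rfl fun ν _ => Finset.sum_congr rfl fun c' _ => ?_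
  rw [hT ν]
  exact Finset.sum_congr rfl fun x _ => hβ _ _

/-! ## §2 The fibre `M_N(ℂ)` with the real trace pairing: symmetric ∕ adjoint letters (n06-j `IsSymmTr ∕ IsAdjTr`) have transpose models -/

section Trace

open B9Thm311ReadingCoords (trIP IsSymmTr IsAdjTr trIP_eq_re_trace)
open scoped Matrix.Norms.L2Operator

variable {N : ℕ}

/-- **the real trace pairing `(v, w) ↦ Re tr(vᴴ w)`** on `M_N(ℂ)` as an ℝ-bilinear form (print's `X·Y`). [cite: Balaban1985BackgroundPropagators, p.392 (X·Y = tr XY), p.393 (scalar products)] -/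
def trReForm : Matrix (Fin N) (Fin N) ℂ →ₗ[ℝ] Matrix (Fin N) (Fin N) ℂ →ₗ[ℝ] ℝ :=
  LinearMap.mk₂ ℝ (fun v w => (Matrix.trace (vᴴ * w)).re)
    (fun v v' w => by simp only [Matrix.conjTranspose_add, Matrix.add_mul, Matrix.trace_add, Complex.add_re])
    (fun r v w => by
      rw [Matrix.conjTranspose_smul, star_trivial, Matrix.smul_mul, Matrix.trace_smul, Complex.real_smul, Complex.re_ofReal_mul, smul_eq_mul])
    (fun v w w' => by simp only [Matrix.mul_add, Matrix.trace_add, Complex.add_re])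
    (fun r v w => by rw [Matrix.mul_smul, Matrix.trace_smul, Complex.real_smul, Complex.re_ofReal_mul, smul_eq_mul])

/-- `trReForm v w = Re tr(vᴴ w)`. [cite: Balaban1985BackgroundPropagators, p.392, bookkeeping] -/
theorem trReForm_apply (v w : Matrix (Fin N) (Fin N) ℂ) : trReForm v w = (Matrix.trace (vᴴ * w)).re := rfl

/-- the real trace pairing is symmetric. [cite: Balaban1985BackgroundPropagators, p.392, bookkeeping] -/
theorem trReForm_symm (v w : Matrix (Fin N) (Fin N) ℂ) : trReForm v w = trReForm w v := by
  rw [trReForm_apply, trReForm_apply, show wᴴ * v = (vᴴ * w)ᴴ by rw [Matrix.conjTranspose_mul, Matrix.conjTranspose_conjTranspose],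
    Matrix.trace_conjTranspose]
  exact (Complex.conj_re _).symm

/-- the carrier sum of the fibre pairing IS n06-j's weight-one trace pairing `trIP 1`. [cite: Balaban1985BackgroundPropagators, p.393 (scalar products), bookkeeping] -/
theorem sum_trReForm_eq_trIP (Φ Ψ : S → Matrix (Fin N) (Fin N) ℂ) : ∑ x, trReForm (Φ x) (Ψ x) = trIP (fun _ => (1 : ℝ)) Φ Ψ := by
  rw [trIP_eq_re_trace]
  exact Finset.sum_congr rfl fun x _ => by rw [trReForm_apply, one_mul]

omit [DecidableEq κ] in
/-- ★★ **A SYMMETRIC LETTER HAS A SELF-TRANSPOSE COORDINATE MODEL** (the knit's `hsym`): for a real basis `b` of `M_N(ℂ)` orthonormal for the trace pairing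
(`repr_c v = Re tr((b c)ᴴ v)`) and a letter `T` symmetric w.r.t. it (`IsSymmTr 1 T` — e.g. `G(U)`, `G′(U)` for unitary-valued `U`: n06-j `GAY_isSymmTr_of`,
`GpY_isSymmTr`), `IsTransposePair (coordOpK b (fun _ => T)) (coordOpK b (fun _ => T))`. [cite: Balaban1985BackgroundPropagators, Thm 3.11 p.416 («symmetric»), p.393; Balaban1984PropagatorsII, (2.51) p.232] -/
theorem isTransposePair_coordOpK_of_isSymmTr (b : Module.Basis κ ℝ (Matrix (Fin N) (Fin N) ℂ))
    (hb : ∀ (v : Matrix (Fin N) (Fin N) ℂ) (c : κ), b.repr v c = (Matrix.trace ((b c)ᴴ * v)).re)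
    (T : (S → Matrix (Fin N) (Fin N) ℂ) →ₗ[ℂ] (S → Matrix (Fin N) (Fin N) ℂ)) (hT : IsSymmTr (fun _ => (1 : ℝ)) T) :
    IsTransposePair (coordOpK (𝔸 := Matrix (Fin N) (Fin N) ℂ) b (fun _ : D => T.restrictScalars ℝ))
      (coordOpK (𝔸 := Matrix (Fin N) (Fin N) ℂ) b (fun _ : D => T.restrictScalars ℝ)) := by
  refine isTransposePair_coordOpK_of_adjoint b trReForm trReForm_symm (fun v c => by rw [hb, trReForm_apply]) _ _ fun ν Φ Ψ => ?_
  simp only [LinearMap.coe_restrictScalars]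
  rw [sum_trReForm_eq_trIP, sum_trReForm_eq_trIP]
  exact (hT Ψ Φ).symm

omit [DecidableEq κ] in
/-- ★★ **ADJOINT LETTER FAMILIES HAVE TRANSPOSE COORDINATE MODELS** (the knit's `htr`, n06-k's `DirTranspose…`): for `b` orthonormal as above and families with
`IsAdjTr 1 1 (T ν) (T′ ν)` (e.g. `∇_{U,ν}` and `∇*_{U,ν}` for unitary-valued `U`), `IsTransposePair (coordOpK b T) (coordOpK b T′)`.
[cite: Balaban1985BackgroundPropagators, (3.8) p.392 (∇* the adjoint of ∇), p.393; Balaban1984PropagatorsII, (2.51) p.232] -/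
theorem isTransposePair_coordOpK_of_isAdjTr (b : Module.Basis κ ℝ (Matrix (Fin N) (Fin N) ℂ))
    (hb : ∀ (v : Matrix (Fin N) (Fin N) ℂ) (c : κ), b.repr v c = (Matrix.trace ((b c)ᴴ * v)).re)
    (T T' : D → (S → Matrix (Fin N) (Fin N) ℂ) →ₗ[ℂ] (S → Matrix (Fin N) (Fin N) ℂ)) (hT : ∀ ν, IsAdjTr (fun _ => (1 : ℝ)) (fun _ => (1 : ℝ)) (T ν) (T' ν)) :
    IsTransposePair (coordOpK (𝔸 := Matrix (Fin N) (Fin N) ℂ) b (fun ν => (T ν).restrictScalars ℝ))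
      (coordOpK (𝔸 := Matrix (Fin N) (Fin N) ℂ) b (fun ν => (T' ν).restrictScalars ℝ)) := by
  refine isTransposePair_coordOpK_of_adjoint b trReForm trReForm_symm (fun v c => by rw [hb, trReForm_apply]) _ _ fun ν Φ Ψ => ?_
  simp only [LinearMap.coe_restrictScalars]
  rw [sum_trReForm_eq_trIP, sum_trReForm_eq_trIP]
  -- `trIP Ψ (T Φ) = trIP (T′ Ψ) Φ`: symmetry of the pairing on both sides of `IsAdjTr`
  have h1 : trIP (fun _ => (1 : ℝ)) Ψ (T ν Φ) = trIP (fun _ => (1 : ℝ)) (T ν Φ) Ψ := by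
    rw [← sum_trReForm_eq_trIP, ← sum_trReForm_eq_trIP]; exact Finset.sum_congr rfl fun x _ => trReForm_symm _ _
  have h2 : trIP (fun _ => (1 : ℝ)) (T' ν Ψ) Φ = trIP (fun _ => (1 : ℝ)) Φ (T' ν Ψ) := by
    rw [← sum_trReForm_eq_trIP, ← sum_trReForm_eq_trIP]; exact Finset.sum_congr rfl fun x _ => trReForm_symm _ _
  rw [h1, h2]
  exact hT ν Φ Ψ

end Trace

/-! ## §3 The bond-sector covariant differences are trace-adjoint at unitary-valued configurations ((3.8), bond sector, physical units) -/

section BondAdjoint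

open scoped Matrix.Norms.L2Operator
open B6KLevelCensusIndexV1 (KIdx)
open B6GlobalChartV1 (PV)
open B9BackgroundsKLevelV1 (shiftsV1)
open B9Thm311DeltaPrimeSymm (conjTranspose_R)
open Node00 (FBondY CfgY cdB cdsB)

variable {N : ℕ} {d ℓ : ℕ} {hd : 1 ≤ d + 1} {hL : Odd (ℓ + 1) ∧ 1 < ℓ + 1} {b₀ b₁ : ℝ} (i : KIdx d ℓ hd hL b₀ b₁)

/-- at a unitary-valued configuration conjugation commutes with the bond-sector covariant difference: `(∇_{U,μ}A)\* = ∇_{U,μ}(A\*)` (componentwise).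
[cite: Balaban1985BackgroundPropagators, (3.3) p.390 + p.392 (hermitian values)] -/
theorem conjTranspose_cdB (U : CfgY (Matrix (Fin N) (Fin N) ℂ) i)
    (hU : ∀ μ x, ((U μ x : (Matrix (Fin N) (Fin N) ℂ)ˣ) : Matrix (Fin N) (Fin N) ℂ) ∈ unitary (Matrix (Fin N) (Fin N) ℂ))
    (μ : Fin (d + 1)) (A : FBondY i → Matrix (Fin N) (Fin N) ℂ) (b : FBondY i) :
    (cdB i U μ A b)ᴴ = cdB i U μ (fun w => (A w)ᴴ) b := by
  unfold cdB B9Eq39Adjoint.covD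
  rw [Matrix.conjTranspose_smul, Complex.star_def, Complex.conj_ofReal, Matrix.conjTranspose_sub, conjTranspose_R _ (hU μ _)]

/-- ★ **(3.8) ON THE BOND SECTOR FOR THE SESQUILINEAR TRACE PAIRING**: `Σ_b tr(A(b)\*(∇\*_{U,μ}G)(b)) = Σ_b tr((∇_{U,μ}A)(b)\*G(b))` at a unitary-valued `U`
(`B9Eq39Adjoint.sum_covD_mul` direction-component by direction-component, read through `(R(V)X)\* = R(V)X\*`).
[cite: Balaban1985BackgroundPropagators, (3.8) p.392] -/
theorem sum_trace_mul_cdsB (U : CfgY (Matrix (Fin N) (Fin N) ℂ) i)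
    (hU : ∀ μ x, ((U μ x : (Matrix (Fin N) (Fin N) ℂ)ˣ) : Matrix (Fin N) (Fin N) ℂ) ∈ unitary (Matrix (Fin N) (Fin N) ℂ))
    (μ : Fin (d + 1)) (A G : FBondY i → Matrix (Fin N) (Fin N) ℂ) :
    ∑ b, Matrix.trace ((A b)ᴴ * cdsB i U μ G b) = ∑ b, Matrix.trace ((cdB i U μ A b)ᴴ * G b) := by
  have htr : ∀ a b : Matrix (Fin N) (Fin N) ℂ,
      Matrix.traceAddMonoidHom (Fin N) ℂ (a * b) = Matrix.traceAddMonoidHom (Fin N) ℂ (b * a) := fun a b => Matrix.trace_mul_comm a b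
  rw [B10StarCount.sum_pbond, B10StarCount.sum_pbond, Finset.sum_comm, Finset.sum_comm (f := fun x ν => Matrix.trace ((cdB i U μ A ⟨x, ν⟩)ᴴ * G ⟨x, ν⟩))]
  refine Finset.sum_congr rfl fun ν _ => ?_
  have h := B9Eq39Adjoint.sum_covD_mul (shiftsV1 (PV d ℓ i.m i.K hd hL)) U (Matrix.traceAddMonoidHom (Fin N) ℂ) htr μ
    (fun s => (A ⟨s, ν⟩)ᴴ) (fun s => G ⟨s, ν⟩)
  have hl : ∀ x, Matrix.trace ((cdB i U μ A ⟨x, ν⟩)ᴴ * G ⟨x, ν⟩) = ((i.cf : ℝ) : ℂ) *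
      Matrix.traceAddMonoidHom (Fin N) ℂ (B9Eq39Adjoint.covD (shiftsV1 (PV d ℓ i.m i.K hd hL)) U μ (fun s => (A ⟨s, ν⟩)ᴴ) x * G ⟨x, ν⟩) := by
    intro x
    rw [conjTranspose_cdB i U hU μ A ⟨x, ν⟩]
    show Matrix.trace ((((i.cf : ℝ) : ℂ) • _) * _) = _
    rw [Matrix.smul_mul, Matrix.trace_smul, smul_eq_mul]
    rfl
  have hr : ∀ x, Matrix.trace ((A ⟨x, ν⟩)ᴴ * cdsB i U μ G ⟨x, ν⟩) = ((i.cf : ℝ) : ℂ) *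
      Matrix.traceAddMonoidHom (Fin N) ℂ ((A ⟨x, ν⟩)ᴴ * B9Eq39Adjoint.covDstar (shiftsV1 (PV d ℓ i.m i.K hd hL)) U μ (fun s => G ⟨s, ν⟩) x) := by
    intro x
    show Matrix.trace (_ * (((i.cf : ℝ) : ℂ) • _)) = _
    rw [Matrix.mul_smul, Matrix.trace_smul, smul_eq_mul]
    rfl
  simp_rw [hl, hr, ← Finset.mul_sum]
  rw [h]

/-- ★ the real-pairing form the coordinate model consumes: `Σ_b Re tr(Ψ(b)\*(∇_{U,μ}F)(b)) = Σ_b Re tr((∇\*_{U,μ}Ψ)(b)\*F(b))` at a unitary-valued `U`.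
[cite: Balaban1985BackgroundPropagators, (3.8) p.392] -/
theorem sum_trReForm_cdB (U : CfgY (Matrix (Fin N) (Fin N) ℂ) i)
    (hU : ∀ μ x, ((U μ x : (Matrix (Fin N) (Fin N) ℂ)ˣ) : Matrix (Fin N) (Fin N) ℂ) ∈ unitary (Matrix (Fin N) (Fin N) ℂ))
    (μ : Fin (d + 1)) (F Ψ : FBondY i → Matrix (Fin N) (Fin N) ℂ) :
    ∑ b, trReForm (Ψ b) (cdB i U μ F b) = ∑ b, trReForm (cdsB i U μ Ψ b) (F b) := by
  -- `Re tr(Ψ\* ∇F) = Re tr((∇F)\* Ψ) = Re tr(F\* ∇\*Ψ) = Re tr((∇\*Ψ)\* F)`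
  have h1 : ∑ b, trReForm (Ψ b) (cdB i U μ F b) = ∑ b, trReForm (cdB i U μ F b) (Ψ b) := Finset.sum_congr rfl fun b _ => trReForm_symm _ _
  have h3 : ∑ b, trReForm (F b) (cdsB i U μ Ψ b) = ∑ b, trReForm (cdsB i U μ Ψ b) (F b) := Finset.sum_congr rfl fun b _ => trReForm_symm _ _
  rw [h1, ← h3]
  simp only [trReForm_apply]
  rw [← Complex.re_sum, ← Complex.re_sum, ← sum_trace_mul_cdsB i U hU μ F Ψ]

end BondAdjoint

/-! ## §4 At the coordinate pins: the knit's `hsym` ∕ `htr` from the genuine symmetry ∕ adjointness -/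

section Pins

open scoped Matrix.Norms.L2Operator
open B6KLevelCensusIndexV1 (KIdx)
open B9Thm311ReadingCoords (IsSymmTr trIP)
open B9CoReadingCoords (GcoK DcoK DscoK cdBₗ cdsBₗ cdBₗ_apply cdsBₗ_apply DcoK_comp_GcoK GcoK_comp_DscoK)
open Node00 (FBondY CfgY BondOpY cdB cdsB)

variable {N : ℕ} {d ℓ : ℕ} {hd : 1 ≤ d + 1} {hL : Odd (ℓ + 1) ∧ 1 < ℓ + 1} {b₀ b₁ : ℝ} (i : KIdx d ℓ hd hL b₀ b₁)
  (b : Module.Basis κ ℝ (Matrix (Fin N) (Fin N) ℂ)) (B : B9.Backgrounds) (cfg : B.Cfg → CfgY (Matrix (Fin N) (Fin N) ℂ) i)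
  (O : BondOpY (Matrix (Fin N) (Fin N) ℂ) i) (U₁ : B.Cfg)

omit [DecidableEq κ] in
/-- ★★ **THE KNIT'S `hsym ∕ hsymA` AT THE PINS**: for an orthonormal trace basis `b` and a letter value `O(U)` symmetric for the trace pairing (n06-j
`symmG_parSymY` ∕ `GpY_isSymmTr` for `G`-valued `U`), the pinned model `GcoK … O U` is its own transpose. [cite: Balaban1985BackgroundPropagators, Thm 3.11 p.416 («symmetric»), p.393; Balaban1984PropagatorsII, (2.51) p.232] -/
theorem isTransposePair_GcoK (hb : ∀ (v : Matrix (Fin N) (Fin N) ℂ) (c : κ), b.repr v c = (Matrix.trace ((b c)ᴴ * v)).re)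
    (hO : IsSymmTr (fun _ => (1 : ℝ)) (O (cfg U₁))) : IsTransposePair (GcoK i b B cfg O U₁) (GcoK i b B cfg O U₁) := by
  unfold GcoK
  exact isTransposePair_smul (isTransposePair_coordOpK_of_isSymmTr b hb (O (cfg U₁)) hO) _

omit [DecidableEq κ] in
/-- ★★ **THE KNIT'S `htr ∕ htrA` AT THE PINS**: with `b` orthonormal, `O(U)` trace-symmetric and `cfg U` unitary-valued, the pinned models satisfy
`IsTransposePair (DcoK ∘ₗ GcoK) (GcoK ∘ₗ DscoK)` — the transpose of `∇_U G(U)` is `G(U) ∇*_U`. [cite: Balaban1985BackgroundPropagators, (3.8) p.392, Thm 3.11 p.416, (3.42) p.397; Balaban1984PropagatorsII, (2.51) p.232] -/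
theorem isTransposePair_DcoK_GcoK (hb : ∀ (v : Matrix (Fin N) (Fin N) ℂ) (c : κ), b.repr v c = (Matrix.trace ((b c)ᴴ * v)).re)
    (hO : IsSymmTr (fun _ => (1 : ℝ)) (O (cfg U₁)))
    (hU : ∀ μ x, ((cfg U₁ μ x : (Matrix (Fin N) (Fin N) ℂ)ˣ) : Matrix (Fin N) (Fin N) ℂ) ∈ unitary (Matrix (Fin N) (Fin N) ℂ)) :
    IsTransposePair (DcoK i b B cfg U₁ ∘ₗ GcoK i b B cfg O U₁) (GcoK i b B cfg O U₁ ∘ₗ DscoK i b B cfg U₁) := by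
  rw [DcoK_comp_GcoK, GcoK_comp_DscoK]
  refine isTransposePair_smul (isTransposePair_coordOpK_of_adjoint b trReForm trReForm_symm (fun v c => by rw [hb, trReForm_apply]) _ _
    fun ν Φ Ψ => ?_) _
  -- `Σ β(Ψ, ∇(OΦ)) = Σ β(∇*Ψ, OΦ) = Σ β(O ∇*Ψ, Φ)`
  have hsymmO : ∀ Φ' Ψ' : FBondY i → Matrix (Fin N) (Fin N) ℂ, ∑ x, trReForm (Ψ' x) (O (cfg U₁) Φ' x) = ∑ x, trReForm (O (cfg U₁) Ψ' x) (Φ' x) := by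
    intro Φ' Ψ'
    rw [sum_trReForm_eq_trIP, sum_trReForm_eq_trIP]
    exact (hO Ψ' Φ').symm
  simp only [LinearMap.comp_apply, LinearMap.coe_restrictScalars, cdBₗ_apply, cdsBₗ_apply]
  rw [sum_trReForm_cdB i (cfg U₁) hU ν, hsymmO]

end Pins

/-! ## §5 The orthonormal real trace basis of `M_N(ℂ)`: the hypothesis `hb` of §2–§4 INHABITED, and the pin corollaries with no basis hypothesis -/

section TraceBasis

open B9Thm311ReadingCoords (cpart cpart_zero cpart_one cpart_add cpart_smul)

variable (N : ℕ)

/-- the index of the real trace coordinates of `M_N(ℂ)`: a matrix unit `(a, a′)` and re ∕ im. [cite: Balaban1985BackgroundPropagators, p.389 (𝔤-valued functions), dictionary] -/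
abbrev TrIdx (N : ℕ) : Type := Fin N × Fin N × Fin 2

/-- the real trace coordinates `v ↦ (Re v_{aa′}, Im v_{aa′})` as an ℝ-linear equivalence `M_N(ℂ) ≃ (TrIdx N → ℝ)`.
[cite: Balaban1985BackgroundPropagators, p.393 (scalar products), dictionary] -/
def trCoords : Matrix (Fin N) (Fin N) ℂ ≃ₗ[ℝ] (TrIdx N → ℝ) where
  toFun v := fun c => cpart c.2.2 (v c.1 c.2.1)
  invFun f := Matrix.of fun a a' => (⟨f (a, a', 0), f (a, a', 1)⟩ : ℂ)
  map_add' v w := by funext c; simp only [Matrix.add_apply, cpart_add, Pi.add_apply]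
  map_smul' r v := by funext c; simp only [Matrix.smul_apply, cpart_smul, RingHom.id_apply, Pi.smul_apply, smul_eq_mul]
  left_inv v := by
    ext a a'
    apply Complex.ext
    · simp [cpart]
    · simp [cpart]
  right_inv f := by
    funext c; obtain ⟨a, a', c⟩ := c; fin_cases c
    · simp [cpart]
    · simp [cpart]

/-- ★ **THE ORTHONORMAL REAL TRACE BASIS OF `M_N(ℂ)`**: the matrix units and their `i`-multiples. [cite: Balaban1985BackgroundPropagators, p.389 + p.393, dictionary] -/
def trBasis : Module.Basis (TrIdx N) ℝ (Matrix (Fin N) (Fin N) ℂ) := Module.Basis.ofEquivFun (trCoords N)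

/-- the coordinates in `trBasis` are the real trace coordinates. [cite: Balaban1985BackgroundPropagators, p.393, bookkeeping] -/
theorem trBasis_repr_apply (v : Matrix (Fin N) (Fin N) ℂ) (c : TrIdx N) : (trBasis N).repr v c = cpart c.2.2 (v c.1 c.2.1) := by
  rw [trBasis, Module.Basis.ofEquivFun_repr_apply]; rfl

/-- the basis vectors: the matrix unit `E_{aa′}` (`c.2.2 = 0`) or `i·E_{aa′}` (`c.2.2 = 1`). [cite: Balaban1985BackgroundPropagators, p.389, bookkeeping] -/
theorem trBasis_apply (c : TrIdx N) (a a' : Fin N) :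
    trBasis N c a a' = if (a, a') = (c.1, c.2.1) then (if c.2.2 = 0 then 1 else Complex.I) else 0 := by
  rw [trBasis, Module.Basis.coe_ofEquivFun]
  show (Matrix.of fun a a' => (⟨(Pi.single c (1 : ℝ) : TrIdx N → ℝ) (a, a', 0), (Pi.single c (1 : ℝ) : TrIdx N → ℝ) (a, a', 1)⟩ : ℂ)) a a' = _
  rw [Matrix.of_apply]
  obtain ⟨c1, c2, c3⟩ := c
  by_cases h : (a, a') = (c1, c2)
  · obtain ⟨rfl, rfl⟩ := Prod.mk.inj h
    rw [if_pos rfl]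
    fin_cases c3
    · simp; rfl
    · simp; rfl
  · rw [if_neg h]
    have h0 : (Pi.single (c1, c2, c3) (1 : ℝ) : TrIdx N → ℝ) (a, a', 0) = 0 := by
      rw [Pi.single_apply, if_neg]; intro hh; apply h; simp only [Prod.mk.injEq] at hh; exact Prod.ext hh.1 hh.2.1
    have h1 : (Pi.single (c1, c2, c3) (1 : ℝ) : TrIdx N → ℝ) (a, a', 1) = 0 := by
      rw [Pi.single_apply, if_neg]; intro hh; apply h; simp only [Prod.mk.injEq] at hh; exact Prod.ext hh.1 hh.2.1
    rw [h0, h1]; rfl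

/-- ★★ **ORTHONORMALITY FOR THE TRACE PAIRING**: `repr_c v = Re tr((trBasis c)ᴴ v)` — the hypothesis `hb` of §2–§4 HOLDS for `trBasis N`.
[cite: Balaban1985BackgroundPropagators, p.393 (scalar products), bookkeeping] -/
theorem trBasis_repr_eq_trace (v : Matrix (Fin N) (Fin N) ℂ) (c : TrIdx N) :
    (trBasis N).repr v c = (Matrix.trace ((trBasis N c)ᴴ * v)).re := by
  rw [trBasis_repr_apply, Matrix.trace]
  simp only [Matrix.diag_apply, Matrix.mul_apply, Matrix.conjTranspose_apply, trBasis_apply]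
  -- only the entry `(c.1, c.2.1)` of the basis vector is non-zero
  rw [Complex.re_sum, Finset.sum_eq_single c.2.1]
  · rw [Complex.re_sum, Finset.sum_eq_single c.1]
    · rw [if_pos rfl]
      obtain ⟨c1, c2, c3⟩ := c
      fin_cases c3
      · simp
      · simp [Complex.mul_re]
    · intro a _ ha
      rw [if_neg (fun h => ha (Prod.mk.inj h).1), star_zero, zero_mul, Complex.zero_re]
    · intro h; exact absurd (Finset.mem_univ _) h
  · intro a' _ ha'
    rw [Complex.re_sum]
    refine Finset.sum_eq_zero fun a _ => ?_
    rw [if_neg (fun h => ha' (Prod.mk.inj h).2), star_zero, zero_mul, Complex.zero_re]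
  · intro h; exact absurd (Finset.mem_univ _) h

end TraceBasis

section PinsTr

open scoped Matrix.Norms.L2Operator
open B6KLevelCensusIndexV1 (KIdx)
open B9Thm311ReadingCoords (IsSymmTr)
open B9CoReadingCoords (GcoK DcoK DscoK)
open Node00 (CfgY BondOpY)

variable {N : ℕ} {d ℓ : ℕ} {hd : 1 ≤ d + 1} {hL : Odd (ℓ + 1) ∧ 1 < ℓ + 1} {b₀ b₁ : ℝ} (i : KIdx d ℓ hd hL b₀ b₁)
  (B : B9.Backgrounds) (cfg : B.Cfg → CfgY (Matrix (Fin N) (Fin N) ℂ) i) (O : BondOpY (Matrix (Fin N) (Fin N) ℂ) i) (U₁ : B.Cfg)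

/-- ★★ the knit's `hsym` at the pins over the trace basis: NO basis hypothesis. [cite: Balaban1985BackgroundPropagators, Thm 3.11 p.416 («symmetric»), p.393] -/
theorem isTransposePair_GcoK_trBasis (hO : IsSymmTr (fun _ => (1 : ℝ)) (O (cfg U₁))) :
    IsTransposePair (GcoK i (trBasis N) B cfg O U₁) (GcoK i (trBasis N) B cfg O U₁) :=
  isTransposePair_GcoK i (trBasis N) B cfg O U₁ (trBasis_repr_eq_trace N) hO

/-- ★★ the knit's `htr` at the pins over the trace basis: NO basis hypothesis (unitary-valued `cfg U`). [cite: Balaban1985BackgroundPropagators, (3.8) p.392, Thm 3.11 p.416] -/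
theorem isTransposePair_DcoK_GcoK_trBasis (hO : IsSymmTr (fun _ => (1 : ℝ)) (O (cfg U₁)))
    (hU : ∀ μ x, ((cfg U₁ μ x : (Matrix (Fin N) (Fin N) ℂ)ˣ) : Matrix (Fin N) (Fin N) ℂ) ∈ unitary (Matrix (Fin N) (Fin N) ℂ)) :
    IsTransposePair (DcoK i (trBasis N) B cfg U₁ ∘ₗ GcoK i (trBasis N) B cfg O U₁) (GcoK i (trBasis N) B cfg O U₁ ∘ₗ DscoK i (trBasis N) B cfg U₁) :=
  isTransposePair_DcoK_GcoK i (trBasis N) B cfg O U₁ (trBasis_repr_eq_trace N) hO hU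

end PinsTr

/-! ## §6 The SITE sector: `hsym ∕ htr` for the G′ walk letters at the pins (`GcoS`, `DcoS`, `DscoS` of `B9CoReadingCoordsS`; (3.8) on sites = n06-j's
`B9Thm311DeltaPrimeSymm.sum_trace_mul_cdsS`) -/

section SitePins

open scoped Matrix.Norms.L2Operator
open B6KLevelCensusIndexV1 (KIdx)
open B9Thm311ReadingCoords (IsSymmTr trIP)
open B9Thm311DeltaPrimeSymm (sum_trace_mul_cdsS)
open B9Ineq349SiteComposite (cdSL cdsSL cdSL_apply cdsSL_apply)
open B9CoReadingCoordsS (GcoS DcoS DscoS DcoS_comp_GcoS GcoS_comp_DscoS)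
open Node00 (SiteY CfgY SiteOpY cdS cdsS)

variable {N : ℕ} {d ℓ : ℕ} {hd : 1 ≤ d + 1} {hL : Odd (ℓ + 1) ∧ 1 < ℓ + 1} {b₀ b₁ : ℝ} (i : KIdx d ℓ hd hL b₀ b₁)

/-- the real-pairing form of (3.8) on the SITE sector at a unitary-valued `U`: `Σ_z Re tr(Ψ(z)\*(∇_{U,μ}F)(z)) = Σ_z Re tr((∇\*_{U,μ}Ψ)(z)\*F(z))`.
[cite: Balaban1985BackgroundPropagators, (3.8) p.392] -/
theorem sum_trReForm_cdS (U : CfgY (Matrix (Fin N) (Fin N) ℂ) i)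
    (hU : ∀ μ x, ((U μ x : (Matrix (Fin N) (Fin N) ℂ)ˣ) : Matrix (Fin N) (Fin N) ℂ) ∈ unitary (Matrix (Fin N) (Fin N) ℂ))
    (μ : Fin (d + 1)) (F Ψ : SiteY i → Matrix (Fin N) (Fin N) ℂ) :
    ∑ z, trReForm (Ψ z) (cdS i U μ F z) = ∑ z, trReForm (cdsS i U μ Ψ z) (F z) := by
  have h1 : ∑ z, trReForm (Ψ z) (cdS i U μ F z) = ∑ z, trReForm (cdS i U μ F z) (Ψ z) := Finset.sum_congr rfl fun z _ => trReForm_symm _ _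
  have h3 : ∑ z, trReForm (F z) (cdsS i U μ Ψ z) = ∑ z, trReForm (cdsS i U μ Ψ z) (F z) := Finset.sum_congr rfl fun z _ => trReForm_symm _ _
  rw [h1, ← h3]
  simp only [trReForm_apply]
  rw [← Complex.re_sum, ← Complex.re_sum, sum_trace_mul_cdsS i U hU μ F Ψ]

variable (b : Module.Basis κ ℝ (Matrix (Fin N) (Fin N) ℂ)) (B : B9.Backgrounds) (cfg : B.Cfg → CfgY (Matrix (Fin N) (Fin N) ℂ) i)
  (O : SiteOpY (Matrix (Fin N) (Fin N) ℂ) i) (U₁ : B.Cfg)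

omit [DecidableEq κ] in
/-- ★★ **THE KNIT'S SITE-SIDE `hsym` AT THE PINS**: `GcoS … O U` is its own transpose when `O(U)` is trace-symmetric (n06-j `GpY_isSymmTr`) and `b` orthonormal.
[cite: Balaban1985BackgroundPropagators, Thm 3.11 p.416 («symmetric»), (3.25) p.395; Balaban1984PropagatorsII, (2.51) p.232] -/
theorem isTransposePair_GcoS (hb : ∀ (v : Matrix (Fin N) (Fin N) ℂ) (c : κ), b.repr v c = (Matrix.trace ((b c)ᴴ * v)).re)
    (hO : IsSymmTr (fun _ => (1 : ℝ)) (O (cfg U₁))) : IsTransposePair (GcoS i b B cfg O U₁) (GcoS i b B cfg O U₁) := by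
  unfold GcoS
  exact isTransposePair_smul (isTransposePair_coordOpK_of_isSymmTr b hb (O (cfg U₁)) hO) _

omit [DecidableEq κ] in
/-- ★★ **THE KNIT'S SITE-SIDE `htr` AT THE PINS**: `IsTransposePair (DcoS ∘ₗ GcoS) (GcoS ∘ₗ DscoS)` for `b` orthonormal, `O(U)` trace-symmetric and `cfg U`
unitary-valued. [cite: Balaban1985BackgroundPropagators, (3.8) p.392, Thm 3.11 p.416, (3.42) p.397; Balaban1984PropagatorsII, (2.51) p.232] -/
theorem isTransposePair_DcoS_GcoS (hb : ∀ (v : Matrix (Fin N) (Fin N) ℂ) (c : κ), b.repr v c = (Matrix.trace ((b c)ᴴ * v)).re)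
    (hO : IsSymmTr (fun _ => (1 : ℝ)) (O (cfg U₁)))
    (hU : ∀ μ x, ((cfg U₁ μ x : (Matrix (Fin N) (Fin N) ℂ)ˣ) : Matrix (Fin N) (Fin N) ℂ) ∈ unitary (Matrix (Fin N) (Fin N) ℂ)) :
    IsTransposePair (DcoS i b B cfg U₁ ∘ₗ GcoS i b B cfg O U₁) (GcoS i b B cfg O U₁ ∘ₗ DscoS i b B cfg U₁) := by
  rw [DcoS_comp_GcoS, GcoS_comp_DscoS]
  refine isTransposePair_smul (isTransposePair_coordOpK_of_adjoint b trReForm trReForm_symm (fun v c => by rw [hb, trReForm_apply]) _ _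
    fun ν Φ Ψ => ?_) _
  have hsymmO : ∀ Φ' Ψ' : SiteY i → Matrix (Fin N) (Fin N) ℂ, ∑ x, trReForm (Ψ' x) (O (cfg U₁) Φ' x) = ∑ x, trReForm (O (cfg U₁) Ψ' x) (Φ' x) := by
    intro Φ' Ψ'
    rw [sum_trReForm_eq_trIP, sum_trReForm_eq_trIP]
    exact (hO Ψ' Φ').symm
  simp only [LinearMap.comp_apply, LinearMap.coe_restrictScalars, cdSL_apply, cdsSL_apply]
  rw [sum_trReForm_cdS i (cfg U₁) hU ν, hsymmO]

omit [DecidableEq κ] [Fintype κ] in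
/-- ★ site-side `hsym` over the trace basis: NO basis hypothesis. [cite: Balaban1985BackgroundPropagators, Thm 3.11 p.416] -/
theorem isTransposePair_GcoS_trBasis (hO : IsSymmTr (fun _ => (1 : ℝ)) (O (cfg U₁))) :
    IsTransposePair (GcoS i (trBasis N) B cfg O U₁) (GcoS i (trBasis N) B cfg O U₁) :=
  isTransposePair_GcoS i (trBasis N) B cfg O U₁ (trBasis_repr_eq_trace N) hO

omit [DecidableEq κ] [Fintype κ] in
/-- ★ site-side `htr` over the trace basis: NO basis hypothesis (unitary-valued `cfg U`). [cite: Balaban1985BackgroundPropagators, (3.8) p.392] -/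
theorem isTransposePair_DcoS_GcoS_trBasis (hO : IsSymmTr (fun _ => (1 : ℝ)) (O (cfg U₁)))
    (hU : ∀ μ x, ((cfg U₁ μ x : (Matrix (Fin N) (Fin N) ℂ)ˣ) : Matrix (Fin N) (Fin N) ℂ) ∈ unitary (Matrix (Fin N) (Fin N) ℂ)) :
    IsTransposePair (DcoS i (trBasis N) B cfg U₁ ∘ₗ GcoS i (trBasis N) B cfg O U₁) (GcoS i (trBasis N) B cfg O U₁ ∘ₗ DscoS i (trBasis N) B cfg U₁) :=
  isTransposePair_DcoS_GcoS i (trBasis N) B cfg O U₁ (trBasis_repr_eq_trace N) hO hU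

end SitePins

end Literature.MathematicalPhysics.QuantumFieldTheory.Balaban1983to89.B9CoReadingCoordsTranspose

end
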